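import Literature.Algebra.Lie.HyperbolicPlaneJordanLefschetzPair
import Literature.Algebra.Lie.LagrangianSplittingGradedPieces
import HarnessLib

/-!
# Looijenga–Lunts (2.9), cases `(B_m, B_{m-1})` / `(D_m, D_{m-1})`, BASIS-FREE: the graded pieces — "`𝔤_0 = 𝔰𝔬(V_0) × 𝔤𝔩(V_2)` and `𝔤_{±2}` projects isomorphically to `Hom(V_0, V_{±2})`" — and the isotropic-lines phrasing

Topic `Literature/Algebra/Lie` (namespace `Literature.Algebra.Lie.HyperbolicPlaneGrading`, continued).  Lane
`lit-hodgefound` (Track 2 foundations library), skeleton seat `lit-hodgefound-skel-1` (generation 52), row **A1-208** of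
`run/shared/lean/pub/lit-hodgefound/SKELETON.md`.  Row A1-203 proved, basis-free over an algebraically closed field of
characteristic `0`, that a hyperbolic pair `e, f` (`B(e,e) = B(f,f) = 0`, `B(e,f) = 1`) in a non-degenerate quadratic
space `(V, B)` grades `𝔰𝔬(V, B)` into a Jordan–Lefschetz pair by `h = h_{e,f}`, `h v = 2(B(v,f) e - B(v,e) f)`
(eigenspaces `V_2 = Ke`, `V_0 = {e,f}^⊥`, `V_{-2} = Kf`).  This file proves the second sentence of (2.9) for this case
AS PRINTED and without coordinates (rows A1-195 / A1-196 have it only as matrix-entry descriptions in a `JD`/`JB`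
basis), over ANY field of characteristic `0` (no algebraic closedness is needed for the description of the pieces):

* the eigenspace decomposition of `h` (§6) and the three `ad h`-degrees POSITIONALLY (§7–§9): `𝔤_0 = {y | y V_2 ⊆ V_2,
  y V_0 ⊆ V_0, y V_{-2} ⊆ V_{-2}}`, `𝔤_2 = {y | y V_2 = 0, y V_{-2} ⊆ V_0, y V_0 ⊆ V_2}`, `𝔤_{-2}` symmetrically;
* **"`𝔤_0 = 𝔰𝔬(V_0) × 𝔤𝔩(V_2)`"**: `y ∈ 𝔤_0` restricts to a skew-adjoint endomorphism of `(V_0, B|_{V_0})` and acts on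
  the line `V_2` by a scalar `a` (then by `-a` on `V_{-2}`), and `y ↦ (y|_{V_0}, a)` is a bijection onto
  `𝔰𝔬(V_0) × K` (`existsUnique_mem_adDegree_zero_restrict_eq`);
* **"`𝔤_{±2}` projects isomorphically to `Hom(V_0, V_{±2})`"**: `y ∈ 𝔤_2` is determined by `u = y f ∈ V_0`
  (`y|_{V_0} = -B(·, u) e`; every `u ∈ V_0` occurs: `y_u = B(·, e) u - B(u, ·) e`), and — for `B` non-degenerate,
  `V` finite-dimensional — `y ↦ y|_{V_0}` is a bijection from `𝔤_2` onto the linear maps `V_0 → V_2`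
  (`existsUnique_mem_adDegree_two_restrict_eq`); `𝔤_{-2}` by the symmetry `e ↔ f` (`h_{f,e} = -h_{e,f}`);
* the data AS PRINTED — "isotropic lines `V_{±2}` such that `V_{-2} ⊕ V_2` is nondegenerate" (§10): such lines carry
  a hyperbolic pair, `h` depends only on the lines, and (with row A1-203) `(𝔰𝔬(V, B), h)` is a Jordan–Lefschetz pair.

THEOREMS ONLY (no definition, no named fact, no `sorry`; net debt `0`); hypotheses style: `V_0` is any submodule `W`
with `w ∈ W ↔ B(w,e) = B(w,f) = 0` (`mem_orthogonal_span_pair_iff` discharges it for `W = {e,f}^⊥`), `h` is any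
`x ∈ 𝔰𝔬(V, B)` with `x = h_{e,f}` as an endomorphism.

## Source, VERBATIM

E. Looijenga, V. A. Lunts, *A Lie algebra attached to a projective variety*, Invent. Math. **129** (1997) 361–412 (held
TeX `paper:arxiv-alg-geom_9604014`), (2.9) p. 10 L94–L103: "Case `(B_m, B_{m-1})` or `(D_m, D_{m-1})`:
`(𝔰𝔬(n), 𝔰𝔬(n-2))` with `m = 2n+1` resp. `m = 2n` (`n ≥ 2`).  Let `V` be a vector space of dimension `n` equipped
with a nondegenerate symmetric bilinear form and let `V_{±2}` be isotropic lines in `V` such that `V_{-2} ⊕ V_2` is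
nondegenerate.  Let `V_0` be the orthogonal complement of `V_{-2} ⊕ V_2` in `V`.  We take `𝔤 = 𝔰𝔬(V)` and let
`h ∈ 𝔰𝔬(V)` be the element with the eigen space decomposition `V_{-2} ⊕ V_0 ⊕ V_2`.  Then
`𝔤_0 = 𝔰𝔬(V_0) × 𝔤𝔩(V_2)` and `𝔤_{±2}` projects isomorphically to `Hom(V_0, V_{±2})`.  We take `M = V`."

## Contents (all proved)

* §6 `sub_smul_sub_smul_orthogonal` (`v - B(v,f)e - B(v,e)f ∈ V_0`), `linearMap_eq_of_eq_on` (maps agreeing on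
  `e`, `f`, `V_0` agree), `apply_eq_zero_iff` / `apply_eq_two_smul_iff` / `apply_eq_neg_two_smul_iff` (the
  eigenspaces `V_0`, `V_2 = Ke`, `V_{-2} = Kf` of `h`), `eq_zero_of_apply_eq_smul` (no other eigenvalue);
* §7 **`mem_adDegree_zero_iff_apply_mem`** (`𝔤_0` positionally), `apply_eq_neg_smul_of_mem_adDegree_zero`
  (`y e = a e ⇒ y f = -a f`), `exists_restrict_eq_of_mem_adDegree_zero` (`y|_{V_0} ∈ 𝔰𝔬(V_0)`),
  `smulRight_sub_smulRight_mem_skewAdjointLieSubalgebra` (`h/2 ∈ 𝔰𝔬(V)`),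
  **`existsUnique_mem_adDegree_zero_restrict_eq`** (`𝔤_0 ≅ 𝔰𝔬(V_0) × 𝔤𝔩(V_2)`);
* §8 `mem_adDegree_two_of_apply`, **`mem_adDegree_two_iff_apply`** (`𝔤_2` positionally), `apply_eq_of_mem_adDegree_two`
  (`y w = -B(w, yf) e`), `eq_zero_of_mem_adDegree_two_of_apply_eq_zero`,
  `smulRight_sub_smulRight_mem_skewAdjointLieSubalgebra'` (`y_u ∈ 𝔰𝔬(V)`), **`existsUnique_mem_adDegree_two_apply_eq`**
  (`𝔤_2 ≅ V_0`, `y ↦ y f`), `mem_orthogonal_span_pair_iff` (`V_0 = {e,f}^⊥`), `restrict_nondegenerate_of_hyperbolic`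
  (`B|_{V_0}` non-degenerate), `eq_zero_of_mem_adDegree_two_of_forall_apply_eq_zero`,
  **`existsUnique_mem_adDegree_two_restrict_eq`** ("`𝔤_2` projects isomorphically to `Hom(V_0, V_2)`");
* §9 `neg_hyperbolicGrading_eq` (`-h_{e,f} = h_{f,e}`), **`mem_adDegree_neg_two_iff_apply`**,
  `apply_eq_of_mem_adDegree_neg_two`, **`existsUnique_mem_adDegree_neg_two_apply_eq`**,
  **`existsUnique_mem_adDegree_neg_two_restrict_eq`** ("`𝔤_{-2}` projects isomorphically to `Hom(V_0, V_{-2})`");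
* §10 `hyperbolicGrading_eq_of_mem_span` (`h` depends only on the lines), `exists_mem_span_isotropic_pairing_one`,
  `apply_ne_zero_of_restrict_span_pair_nondegenerate` ("`V_{-2} ⊕ V_2` nondegenerate" ⇒ `B(e₀, f₀) ≠ 0`),
  **`exists_isJordanLefschetzPair_of_isotropic_lines`** ((2.9) with isotropic lines as data; `K` algebraically closed
  of characteristic `0`, `dim V ≥ 3`, by row A1-203).

## SCOPE (what is NOT formalised here)

No `LinearEquiv`/`LieEquiv` is bundled (the identifications are `∃!` statements with the explicit inverse described);
the Lie bracket on `𝔰𝔬(V_0) × 𝔤𝔩(V_2)` is not compared (only the underlying bijection); the fundamental representation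
"We take `M = V`" is not touched.

## References

* [LooijengaLunts1997] E. Looijenga, V. A. Lunts, *A Lie algebra attached to a projective variety*, Invent. Math. 129
  (1997) 361–412; arXiv:alg-geom/9604014. §2 (2.9) p. 10 L94–L103 (held `paper:arxiv-alg-geom_9604014`).
-/

namespace Literature.Algebra.Lie.HyperbolicPlaneGrading

open Module LieAlgebra Function Literature.Algebra.Lie

variable {K : Type*} [Field K] {V : Type*} [AddCommGroup V] [Module K V] {B : LinearMap.BilinForm K V}

/-! ### §6 The eigenspace decomposition `V = V_2 ⊕ V_0 ⊕ V_{-2}` of `h_{e,f}`: `V_2 = Ke`, `V_0 = {e,f}^⊥`, `V_{-2} = Kf` -/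

section Eigen

variable {e f : V}

/-- The decomposition of a vector along `V = Ke ⊕ {e,f}^⊥ ⊕ Kf`: `v - B(v,f) e - B(v,e) f ⊥ e, f`. [cite: LooijengaLunts1997, §2 (2.9) p. 10 L96–L101 ("Let V_0 be the orthogonal complement of V_{-2} ⊕ V_2 in V")] -/
theorem sub_smul_sub_smul_orthogonal (hs : ∀ u v : V, B u v = B v u) (he : B e e = 0) (hf : B f f = 0)
    (hef : B e f = 1) (v : V) :
    B (v - B v f • e - B v e • f) e = 0 ∧ B (v - B v f • e - B v e • f) f = 0 := by
  refine ⟨?_, ?_⟩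
  · rw [LinearMap.BilinForm.sub_left, LinearMap.BilinForm.sub_left, LinearMap.BilinForm.smul_left,
      LinearMap.BilinForm.smul_left, he, hs f e, hef]; ring
  · rw [LinearMap.BilinForm.sub_left, LinearMap.BilinForm.sub_left, LinearMap.BilinForm.smul_left,
      LinearMap.BilinForm.smul_left, hef, hf]; ring

/-- Two linear maps out of `V` that agree on `e`, on `f` and on `{e,f}^⊥` agree. [cite: LooijengaLunts1997, §2 (2.9) p. 10 L96–L101 ("the eigen space decomposition V_{-2} ⊕ V_0 ⊕ V_2")] -/
theorem linearMap_eq_of_eq_on (hs : ∀ u v : V, B u v = B v u) (he : B e e = 0) (hf : B f f = 0) (hef : B e f = 1)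
    {N : Type*} [AddCommGroup N]
    [Module K N] (φ ψ : V →ₗ[K] N) (h₁ : φ e = ψ e) (h₂ : φ f = ψ f)
    (h₀ : ∀ w, B w e = 0 → B w f = 0 → φ w = ψ w) : φ = ψ := by
  ext v
  obtain ⟨h1, h2⟩ := sub_smul_sub_smul_orthogonal hs he hf hef v
  have hv : v = (v - B v f • e - B v e • f) + B v f • e + B v e • f := by abel
  rw [hv, map_add, map_add, map_add, map_add, map_smul, map_smul, map_smul, map_smul, h₁, h₂, h₀ _ h1 h2]

variable [CharZero K]

/-- `x v = 0 ⟺ v ∈ V_0 = {e,f}^⊥`. [cite: LooijengaLunts1997, §2 (2.9) p. 10 L96–L101] -/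
theorem apply_eq_zero_iff (hs : ∀ u v : V, B u v = B v u) (he : B e e = 0) (hf : B f f = 0) (hef : B e f = 1)
    (x : Module.End K V) (hx : x = (2 : K) • ((B.flip f).smulRight e - (B.flip e).smulRight f)) (v : V) :
    x v = 0 ↔ B v e = 0 ∧ B v f = 0 := by
  rw [hx, hyperbolicGrading_apply, smul_eq_zero, or_iff_right (two_ne_zero' K)]
  constructor
  · intro h
    have h' := (LinearIndependent.pair_iff.1 (linearIndependent_pair hs he hf hef)) (B v f) (-B v e)
      (by rwa [neg_smul, ← sub_eq_add_neg])
    exact ⟨neg_eq_zero.1 h'.2, h'.1⟩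
  · rintro ⟨h1, h2⟩
    rw [h1, h2, zero_smul, zero_smul, sub_zero]

/-- `x v = 2v ⟺ v ∈ V_2 = Ke`. [cite: LooijengaLunts1997, §2 (2.9) p. 10 L96–L101] -/
theorem apply_eq_two_smul_iff (hs : ∀ u v : V, B u v = B v u) (he : B e e = 0) (hef : B e f = 1)
    (x : Module.End K V) (hx : x = (2 : K) • ((B.flip f).smulRight e - (B.flip e).smulRight f)) (v : V) :
    x v = (2 : K) • v ↔ v ∈ K ∙ e := by
  rw [hx, hyperbolicGrading_apply, Submodule.mem_span_singleton]
  constructor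
  · intro h
    have hv : v = B v f • e - B v e • f := smul_right_injective V (two_ne_zero' K) h.symm
    have h1 : B v e = 0 := by
      have h' := congrArg (fun w ↦ B w e) hv
      simp only [LinearMap.BilinForm.sub_left, LinearMap.BilinForm.smul_left, he, hs f e, hef, mul_zero, mul_one,
        zero_sub] at h'
      -- `h' : B v e = -B v e`
      have : (2 : K) * B v e = 0 := by rw [two_mul]; nth_rw 2 [h']; exact add_neg_cancel _
      exact (mul_eq_zero.1 this).resolve_left (two_ne_zero' K)
    exact ⟨B v f, by rw [hv, h1, zero_smul, sub_zero, LinearMap.BilinForm.smul_left, hef, mul_one]⟩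
  · rintro ⟨a, rfl⟩
    rw [LinearMap.BilinForm.smul_left, LinearMap.BilinForm.smul_left, hef, he, mul_one, mul_zero, zero_smul, sub_zero]

/-- `x v = -2v ⟺ v ∈ V_{-2} = Kf`. [cite: LooijengaLunts1997, §2 (2.9) p. 10 L96–L101] -/
theorem apply_eq_neg_two_smul_iff (hs : ∀ u v : V, B u v = B v u) (hf : B f f = 0) (hef : B e f = 1)
    (x : Module.End K V) (hx : x = (2 : K) • ((B.flip f).smulRight e - (B.flip e).smulRight f)) (v : V) :
    x v = -((2 : K) • v) ↔ v ∈ K ∙ f := by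
  rw [hx, hyperbolicGrading_apply, Submodule.mem_span_singleton, ← smul_neg]
  constructor
  · intro h
    have hv : -v = B v f • e - B v e • f := smul_right_injective V (two_ne_zero' K) h.symm
    rw [neg_eq_iff_eq_neg, neg_sub] at hv
    have h1 : B v f = 0 := by
      have h' := congrArg (fun w ↦ B w f) hv
      simp only [LinearMap.BilinForm.sub_left, LinearMap.BilinForm.smul_left, hf, hef, mul_zero, mul_one,
        zero_sub] at h'
      have : (2 : K) * B v f = 0 := by rw [two_mul]; nth_rw 2 [h']; exact add_neg_cancel _
      exact (mul_eq_zero.1 this).resolve_left (two_ne_zero' K)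
    exact ⟨B v e, by rw [hv, h1, zero_smul, sub_zero, LinearMap.BilinForm.smul_left, hs f e, hef, mul_one]⟩
  · rintro ⟨a, rfl⟩
    rw [LinearMap.BilinForm.smul_left, LinearMap.BilinForm.smul_left, hs f e, hef, hf, mul_one, mul_zero, zero_smul,
      zero_sub, smul_neg]

/-- No other eigenvalue: `x v = c v` with `c ∉ {2, 0, -2}` forces `v = 0`. [cite: LooijengaLunts1997, §2 (2.9) p. 10 L96–L101] -/
theorem eq_zero_of_apply_eq_smul (hs : ∀ u v : V, B u v = B v u) (he : B e e = 0) (hf : B f f = 0)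
    (hef : B e f = 1) (x : Module.End K V) (hx : x = (2 : K) • ((B.flip f).smulRight e - (B.flip e).smulRight f))
    {c : K} (hc2 : c ≠ 2) (hc0 : c ≠ 0) (hcn2 : c ≠ -2) {v : V} (hv : x v = c • v) : v = 0 := by
  have h1 : B v e = 0 := by
    have h' := congrArg (fun w ↦ B w e) hv
    simp only [hx, hyperbolicGrading_apply, LinearMap.BilinForm.smul_left, LinearMap.BilinForm.sub_left, he, hs f e,
      hef, mul_zero, mul_one, zero_sub] at h'
    -- `h' : 2 * -B v e = c * B v e`
    have : (c + 2) * B v e = 0 := by rw [add_mul, ← h']; ring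
    exact (mul_eq_zero.1 this).resolve_left fun h ↦ hcn2 (eq_neg_of_add_eq_zero_left h)
  have h2 : B v f = 0 := by
    have h' := congrArg (fun w ↦ B w f) hv
    simp only [hx, hyperbolicGrading_apply, LinearMap.BilinForm.smul_left, LinearMap.BilinForm.sub_left, hef, hf,
      mul_zero, mul_one, sub_zero] at h'
    -- `h' : 2 * B v f = c * B v f`
    have : (c - 2) * B v f = 0 := by rw [sub_mul, ← h']; ring
    exact (mul_eq_zero.1 this).resolve_left (sub_ne_zero.2 hc2)
  have h0 : x v = 0 := (apply_eq_zero_iff hs he hf hef x hx v).2 ⟨h1, h2⟩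
  rw [h0, eq_comm, smul_eq_zero] at hv
  exact hv.resolve_left hc0

end Eigen

/-! ### §7 `𝔤_0 = 𝔰𝔬(V_0) × 𝔤𝔩(V_2)` -/

section DegreeZero

variable [CharZero K] {e f : V} {W : Submodule K V}

/-- **`𝔤_0` positionally**: `y ∈ 𝔰𝔬(V, B)` has `ad h`-degree `0` iff it preserves the three eigenspaces
`V_2 = Ke`, `V_0 = {e,f}^⊥`, `V_{-2} = Kf`. [cite: LooijengaLunts1997, §2 (2.9) p. 10 L100–L102 ("Then 𝔤_0 = 𝔰𝔬(V_0) × 𝔤𝔩(V_2)")] -/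
theorem mem_adDegree_zero_iff_apply_mem (hs : ∀ u v : V, B u v = B v u) (he : B e e = 0) (hf : B f f = 0)
    (hef : B e f = 1) (hW : ∀ w, w ∈ W ↔ B w e = 0 ∧ B w f = 0) (x : skewAdjointLieSubalgebra B)
    (hx : (x : Module.End K V) = (2 : K) • ((B.flip f).smulRight e - (B.flip e).smulRight f))
    (y : skewAdjointLieSubalgebra B) :
    y ∈ adDegree K x 0 ↔ (y : Module.End K V) e ∈ K ∙ e ∧ (y : Module.End K V) f ∈ K ∙ f ∧
      ∀ w ∈ W, (y : Module.End K V) w ∈ W := by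
  obtain ⟨hxe, hxf, hx0⟩ := hyperbolicGrading_apply_eq (K := K) hs he hf hef
  rw [← hx] at hxe hxf hx0
  rw [LagrangianSplittingGrading.mem_adDegree_zero_iff_commute]
  constructor
  · intro hc
    refine ⟨(apply_eq_two_smul_iff hs he hef _ hx _).1 (by rw [hc, hxe, map_smul]),
      (apply_eq_neg_two_smul_iff hs hf hef _ hx _).1 (by rw [hc, hxf, map_neg, map_smul]), fun w hw ↦ ?_⟩
    obtain ⟨h1, h2⟩ := (hW w).1 hw
    exact (hW _).2 ((apply_eq_zero_iff hs he hf hef _ hx _).1 (by rw [hc, hx0 w h1 h2, map_zero]))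
  · rintro ⟨h₁, h₂, h₀⟩
    obtain ⟨a, ha⟩ := Submodule.mem_span_singleton.1 h₁
    obtain ⟨b, hb⟩ := Submodule.mem_span_singleton.1 h₂
    intro v
    have key := linearMap_eq_of_eq_on hs he hf hef ((x : Module.End K V) * (y : Module.End K V))
      ((y : Module.End K V) * (x : Module.End K V))
      (by rw [Module.End.mul_apply, Module.End.mul_apply, ← ha, map_smul, hxe, map_smul, ← ha, smul_comm])
      (by rw [Module.End.mul_apply, Module.End.mul_apply, ← hb, map_smul, hxf, map_neg, map_smul, ← hb, smul_neg,
        smul_comm])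
      (fun w h1 h2 ↦ by
        obtain ⟨h1', h2'⟩ := (hW _).1 (h₀ w ((hW w).2 ⟨h1, h2⟩))
        rw [Module.End.mul_apply, Module.End.mul_apply, hx0 w h1 h2, map_zero, hx0 _ h1' h2'])
    exact LinearMap.congr_fun key v

/-- The `𝔤𝔩(V_2)`-component determines the `V_{-2}`-component: if `y ∈ 𝔤_0` has `y e = a e` then `y f = -a f`
(skew-adjointness, `B(e, f) = 1`). [cite: LooijengaLunts1997, §2 (2.9) p. 10 L100–L102] -/
theorem apply_eq_neg_smul_of_mem_adDegree_zero (hs : ∀ u v : V, B u v = B v u) (he : B e e = 0) (hf : B f f = 0)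
    (hef : B e f = 1) (hW : ∀ w, w ∈ W ↔ B w e = 0 ∧ B w f = 0) (x : skewAdjointLieSubalgebra B)
    (hx : (x : Module.End K V) = (2 : K) • ((B.flip f).smulRight e - (B.flip e).smulRight f))
    (y : skewAdjointLieSubalgebra B) (hy : y ∈ adDegree K x 0) {a : K} (ha : (y : Module.End K V) e = a • e) :
    (y : Module.End K V) f = -(a • f) := by
  obtain ⟨-, h₂, -⟩ := (mem_adDegree_zero_iff_apply_mem hs he hf hef hW x hx y).1 hy
  obtain ⟨b, hb⟩ := Submodule.mem_span_singleton.1 h₂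
  have h := (LinearMap.mem_skewAdjointSubmodule (y : Module.End K V)).1 y.2 e f
  rw [Pi.neg_apply, LinearMap.BilinForm.neg_right, ha, ← hb, LinearMap.BilinForm.smul_left,
    LinearMap.BilinForm.smul_right, hef, mul_one, mul_one] at h
  rw [← hb, h, neg_smul, neg_neg]

/-- The `𝔰𝔬(V_0)`-component: an element of `𝔤_0` restricts to a skew-adjoint endomorphism of `(V_0, B|_{V_0})`.
[cite: LooijengaLunts1997, §2 (2.9) p. 10 L100–L102 ("𝔤_0 = 𝔰𝔬(V_0) × 𝔤𝔩(V_2)")] -/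
theorem exists_restrict_eq_of_mem_adDegree_zero (hs : ∀ u v : V, B u v = B v u) (he : B e e = 0) (hf : B f f = 0)
    (hef : B e f = 1) (hW : ∀ w, w ∈ W ↔ B w e = 0 ∧ B w f = 0) (x : skewAdjointLieSubalgebra B)
    (hx : (x : Module.End K V) = (2 : K) • ((B.flip f).smulRight e - (B.flip e).smulRight f))
    (y : skewAdjointLieSubalgebra B) (hy : y ∈ adDegree K x 0) :
    ∃ z : skewAdjointLieSubalgebra (B.restrict W), ∀ w : W, ((z : Module.End K W) w : V) = (y : Module.End K V) w := by
  obtain ⟨-, -, h₀⟩ := (mem_adDegree_zero_iff_apply_mem hs he hf hef hW x hx y).1 hy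
  have hskew : ∀ a b, B ((y : Module.End K V) a) b = -B a ((y : Module.End K V) b) := fun a b ↦ by
    have h := (LinearMap.mem_skewAdjointSubmodule (y : Module.End K V)).1 y.2 a b
    rwa [Pi.neg_apply, LinearMap.BilinForm.neg_right] at h
  refine ⟨⟨(y : Module.End K V).restrict h₀, ?_⟩, fun w ↦ rfl⟩
  show (y : Module.End K V).restrict h₀ ∈ (B.restrict W).skewAdjointSubmodule
  rw [LinearMap.mem_skewAdjointSubmodule]
  intro a b
  simp only [Pi.neg_apply, Submodule.coe_neg, LinearMap.BilinForm.neg_right,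
    LinearMap.BilinForm.restrict_apply, LinearMap.domRestrict_apply, LinearMap.coe_restrict_apply]
  exact hskew a b

/-- The endomorphism `M = B(·, f) e - B(·, e) f` (`= h/2`) is skew-adjoint. [cite: LooijengaLunts1997, §2 (2.9) p. 10 L100–L101] -/
theorem smulRight_sub_smulRight_mem_skewAdjointLieSubalgebra (hs : ∀ u v : V, B u v = B v u) (e f : V) :
    ((B.flip f).smulRight e - (B.flip e).smulRight f : Module.End K V) ∈ skewAdjointLieSubalgebra B := by
  letI : LieRing (Module.End K V) := LieRing.ofAssociativeRing
  have h2 : ((2 : K)⁻¹ * 2) = 1 := inv_mul_cancel₀ (two_ne_zero' K)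
  have h := (skewAdjointLieSubalgebra B).smul_mem (2 : K)⁻¹ (hyperbolicGrading_mem_skewAdjointLieSubalgebra hs e f)
  rwa [smul_smul, h2, one_smul] at h

/-- **`𝔤_0 → 𝔰𝔬(V_0) × 𝔤𝔩(V_2)` is bijective**: for every skew-adjoint `z` of `(V_0, B|_{V_0})` and every scalar `a`
(an element of `𝔤𝔩(V_2) = K`) there is a unique `y ∈ 𝔤_0` with `y|_{V_0} = z` and `y e = a e` (then `y f = -a f`).
[cite: LooijengaLunts1997, §2 (2.9) p. 10 L100–L102 ("Then 𝔤_0 = 𝔰𝔬(V_0) × 𝔤𝔩(V_2)")] -/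
theorem existsUnique_mem_adDegree_zero_restrict_eq (hs : ∀ u v : V, B u v = B v u) (he : B e e = 0)
    (hf : B f f = 0) (hef : B e f = 1) (hW : ∀ w, w ∈ W ↔ B w e = 0 ∧ B w f = 0) (x : skewAdjointLieSubalgebra B)
    (hx : (x : Module.End K V) = (2 : K) • ((B.flip f).smulRight e - (B.flip e).smulRight f))
    (z : skewAdjointLieSubalgebra (B.restrict W)) (a : K) :
    ∃! y : skewAdjointLieSubalgebra B, y ∈ adDegree K x 0 ∧
      (∀ w : W, (y : Module.End K V) w = (z : Module.End K W) w) ∧ (y : Module.End K V) e = a • e := by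
  letI : LieRing (Module.End K V) := LieRing.ofAssociativeRing
  -- the projection `π : V → V_0`, `π v = v - B(v,f) e - B(v,e) f`
  let π : V →ₗ[K] W := LinearMap.codRestrict W (LinearMap.id - (B.flip f).smulRight e - (B.flip e).smulRight f)
    fun v ↦ (hW _).2 (sub_smul_sub_smul_orthogonal hs he hf hef v)
  have hπ : ∀ v, (π v : V) = v - B v f • e - B v e • f := fun v ↦ rfl
  have hπe : π e = 0 := by
    apply Subtype.ext; rw [hπ, hef, he, one_smul, zero_smul, sub_zero, sub_self, ZeroMemClass.coe_zero]
  have hπf : π f = 0 := by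
    apply Subtype.ext; rw [hπ, hf, hs f e, hef, zero_smul, one_smul, sub_zero, sub_self, ZeroMemClass.coe_zero]
  have hπw : ∀ w : W, π w = w := fun w ↦ by
    obtain ⟨h1, h2⟩ := (hW _).1 w.2
    apply Subtype.ext; rw [hπ, h1, h2, zero_smul, zero_smul, sub_zero, sub_zero]
  -- orthogonality of `V_0` to `e, f`: `B(w, v) = B(w, π v)`
  have hWπ : ∀ w ∈ W, ∀ v, B w v = B w (π v) := fun w hw v ↦ by
    obtain ⟨h1, h2⟩ := (hW _).1 hw
    rw [hπ, LinearMap.BilinForm.sub_right, LinearMap.BilinForm.sub_right, LinearMap.BilinForm.smul_right,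
      LinearMap.BilinForm.smul_right, h1, h2, mul_zero, mul_zero, sub_zero, sub_zero]
  -- the candidate `y = z ∘ π + a M`
  set M : Module.End K V := (B.flip f).smulRight e - (B.flip e).smulRight f with hM
  have hMapp : ∀ v, M v = B v f • e - B v e • f := fun v ↦ by
    simp only [hM, LinearMap.sub_apply, LinearMap.smulRight_apply, LinearMap.BilinForm.flip_apply]
  let Z : Module.End K V := W.subtype ∘ₗ (z : Module.End K W) ∘ₗ π
  have hZ : ∀ v, Z v = ((z : Module.End K W) (π v) : V) := fun v ↦ rfl
  have hzskew : ∀ a b : W, B ((z : Module.End K W) a : V) b = -B (a : V) ((z : Module.End K W) b) := fun a b ↦ by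
    have h := (LinearMap.mem_skewAdjointSubmodule (z : Module.End K W)).1 z.2 a b
    simpa only [Pi.neg_apply, Submodule.coe_neg, LinearMap.BilinForm.neg_right,
      LinearMap.BilinForm.restrict_apply, LinearMap.domRestrict_apply] using h
  have hZmem : Z ∈ skewAdjointLieSubalgebra B := by
    show Z ∈ B.skewAdjointSubmodule
    rw [LinearMap.mem_skewAdjointSubmodule]
    intro v w
    rw [Pi.neg_apply, LinearMap.BilinForm.neg_right, hZ, hZ, hWπ _ ((z : Module.End K W) (π v)).2 w,
      hs v, hWπ _ ((z : Module.End K W) (π w)).2 v, hzskew, hs]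
  let y : Module.End K V := Z + a • M
  have hymem : y ∈ skewAdjointLieSubalgebra B :=
    add_mem hZmem ((skewAdjointLieSubalgebra B).smul_mem a (smulRight_sub_smulRight_mem_skewAdjointLieSubalgebra hs e f))
  have hye : y e = a • e := by
    rw [LinearMap.add_apply, hZ, hπe, map_zero, ZeroMemClass.coe_zero, zero_add, LinearMap.smul_apply, hMapp, hef, he,
      one_smul, zero_smul, sub_zero]
  have hyf : y f = -(a • f) := by
    rw [LinearMap.add_apply, hZ, hπf, map_zero, ZeroMemClass.coe_zero, zero_add, LinearMap.smul_apply, hMapp, hf,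
      hs f e, hef, zero_smul, one_smul, zero_sub, smul_neg]
  have hyw : ∀ w : W, y w = (z : Module.End K W) w := fun w ↦ by
    obtain ⟨h1, h2⟩ := (hW _).1 w.2
    rw [LinearMap.add_apply, hZ, hπw, LinearMap.smul_apply, hMapp, h1, h2, zero_smul, zero_smul, sub_zero, smul_zero,
      add_zero]
  have hy0 : (⟨y, hymem⟩ : skewAdjointLieSubalgebra B) ∈ adDegree K x 0 := by
    rw [mem_adDegree_zero_iff_apply_mem hs he hf hef hW x hx]
    refine ⟨Submodule.mem_span_singleton.2 ⟨a, hye.symm⟩, Submodule.mem_span_singleton.2 ⟨-a, ?_⟩, fun w hw ↦ ?_⟩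
    · change -a • f = y f
      rw [hyf, neg_smul]
    · change y w ∈ W
      rw [hyw ⟨w, hw⟩]; exact ((z : Module.End K W) ⟨w, hw⟩).2
  refine ⟨⟨y, hymem⟩, ⟨hy0, hyw, hye⟩, fun y' ⟨hy', hy'w, hy'e⟩ ↦ ?_⟩
  -- uniqueness: the difference vanishes on `e`, `f`, `V_0`
  apply Subtype.ext
  have hd0 : y' - ⟨y, hymem⟩ ∈ adDegree K x 0 := Submodule.sub_mem _ hy' hy0
  have hde : ((y' - ⟨y, hymem⟩ : skewAdjointLieSubalgebra B) : Module.End K V) e = (0 : K) • e := by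
    change ((y' : Module.End K V) - y) e = (0 : K) • e
    rw [LinearMap.sub_apply, hy'e, hye, sub_self, zero_smul]
  have hdf := apply_eq_neg_smul_of_mem_adDegree_zero hs he hf hef hW x hx _ hd0 hde
  change ((y' : Module.End K V) - y) f = -((0 : K) • f) at hdf
  rw [zero_smul, neg_zero, LinearMap.sub_apply, sub_eq_zero] at hdf
  refine linearMap_eq_of_eq_on hs he hf hef _ _ (by rw [hy'e]; exact hye.symm) hdf fun w h1 h2 ↦ ?_
  change (y' : Module.End K V) w = y w
  exact (hy'w ⟨w, (hW w).2 ⟨h1, h2⟩⟩).trans (hyw ⟨w, (hW w).2 ⟨h1, h2⟩⟩).symm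

end DegreeZero

/-! ### §8 `𝔤_2` positionally and "`𝔤_2` projects isomorphically to `Hom(V_0, V_2)`" -/

section DegreeTwo

variable {e f : V} {W : Submodule K V}

/-- Degree `2` from the position alone: if `y e = 0`, `y f ⊥ e, f` and `y V_0 ⊆ Ke` then `[h, y] = 2y`. [cite: LooijengaLunts1997, §2 (2.9) p. 10 L101–L103 ("𝔤_{±2} projects isomorphically to Hom(V_0, V_{±2})")] -/
theorem mem_adDegree_two_of_apply (hs : ∀ u v : V, B u v = B v u) (he : B e e = 0) (hf : B f f = 0) (hef : B e f = 1)
    (hW : ∀ w, w ∈ W ↔ B w e = 0 ∧ B w f = 0) (x : skewAdjointLieSubalgebra B)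
    (hx : (x : Module.End K V) = (2 : K) • ((B.flip f).smulRight e - (B.flip e).smulRight f))
    (y : skewAdjointLieSubalgebra B) (h₁ : (y : Module.End K V) e = 0) (h₂ : (y : Module.End K V) f ∈ W)
    (h₀ : ∀ w ∈ W, (y : Module.End K V) w ∈ K ∙ e) : y ∈ adDegree K x 2 := by
  obtain ⟨hxe, hxf, hx0⟩ := hyperbolicGrading_apply_eq (K := K) hs he hf hef
  rw [← hx] at hxe hxf hx0
  rw [LagrangianSplittingGrading.mem_adDegree_iff_apply]
  intro v
  have key := linearMap_eq_of_eq_on hs he hf hef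
    ((x : Module.End K V) * (y : Module.End K V) - (y : Module.End K V) * (x : Module.End K V))
    ((2 : K) • (y : Module.End K V))
    (by rw [LinearMap.sub_apply, Module.End.mul_apply, Module.End.mul_apply, h₁, map_zero, hxe, map_smul, h₁, smul_zero,
      sub_zero, LinearMap.smul_apply, h₁, smul_zero])
    (by
      obtain ⟨h1, h2⟩ := (hW _).1 h₂
      rw [LinearMap.sub_apply, Module.End.mul_apply, Module.End.mul_apply, hx0 _ h1 h2, hxf, map_neg, map_smul,
        zero_sub, neg_neg, LinearMap.smul_apply])
    (fun w h1 h2 ↦ by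
      obtain ⟨c, hc⟩ := Submodule.mem_span_singleton.1 (h₀ w ((hW w).2 ⟨h1, h2⟩))
      rw [LinearMap.sub_apply, Module.End.mul_apply, Module.End.mul_apply, hx0 w h1 h2, map_zero, sub_zero, ← hc,
        map_smul, hxe, LinearMap.smul_apply, ← hc, smul_comm])
  have h := LinearMap.congr_fun key v
  rwa [LinearMap.sub_apply, Module.End.mul_apply, Module.End.mul_apply, LinearMap.smul_apply] at h

/-- The element `y_u = B(·, e) u - B(u, ·) e` attached to `u ∈ V_0` is skew-adjoint. [cite: LooijengaLunts1997, §2 (2.9) p. 10 L101–L103] -/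
theorem smulRight_sub_smulRight_mem_skewAdjointLieSubalgebra' (hs : ∀ u v : V, B u v = B v u) (e u : V) :
    ((B.flip e).smulRight u - (B u).smulRight e : Module.End K V) ∈ skewAdjointLieSubalgebra B := by
  show ((B.flip e).smulRight u - (B u).smulRight e : Module.End K V) ∈ B.skewAdjointSubmodule
  rw [LinearMap.mem_skewAdjointSubmodule]
  intro v w
  simp only [Pi.neg_apply, LinearMap.sub_apply, LinearMap.smulRight_apply, LinearMap.BilinForm.flip_apply,
    LinearMap.BilinForm.neg_right, LinearMap.BilinForm.sub_left, LinearMap.BilinForm.smul_left,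
    LinearMap.BilinForm.sub_right, LinearMap.BilinForm.smul_right, hs u, hs e]
  ring

/-- `V_0` is the orthogonal complement of the hyperbolic plane `Ke ⊕ Kf`. [cite: LooijengaLunts1997, §2 (2.9) p. 10 L99–L100 ("Let V_0 be the orthogonal complement of V_{-2} ⊕ V_2 in V")] -/
theorem mem_orthogonal_span_pair_iff (hs : ∀ u v : V, B u v = B v u) (e f w : V) :
    w ∈ B.orthogonal (Submodule.span K (Set.range ![e, f])) ↔ B w e = 0 ∧ B w f = 0 := by
  rw [LinearMap.BilinForm.mem_orthogonal_iff]
  constructor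
  · intro h
    exact ⟨by rw [hs]; exact h e (Submodule.subset_span ⟨0, rfl⟩), by rw [hs]; exact h f (Submodule.subset_span ⟨1, rfl⟩)⟩
  · rintro ⟨h1, h2⟩ n hn
    rw [hs]
    refine Submodule.span_induction (p := fun n _ ↦ B w n = 0) ?_ ?_ ?_ ?_ hn
    · rintro _ ⟨i, rfl⟩
      fin_cases i
      · exact h1
      · exact h2
    · exact LinearMap.BilinForm.zero_right w
    · intro a b _ _ ha hb; rw [LinearMap.BilinForm.add_right, ha, hb, add_zero]
    · intro c a _ ha; rw [LinearMap.BilinForm.smul_right, ha, mul_zero]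

/-- `B|_{V_0}` is non-degenerate (`V_0^⊥ = Ke ⊕ Kf` is a complement of `V_0`). [cite: LooijengaLunts1997, §2 (2.9) p. 10 L96–L100] -/
theorem restrict_nondegenerate_of_hyperbolic [FiniteDimensional K V] (hB : B.Nondegenerate)
    (hs : ∀ u v : V, B u v = B v u) (he : B e e = 0) (hf : B f f = 0) (hef : B e f = 1)
    (hW : ∀ w, w ∈ W ↔ B w e = 0 ∧ B w f = 0) : (B.restrict W).Nondegenerate := by
  have hrefl : B.IsRefl := (LinearMap.BilinForm.isSymm_def.2 hs).isRefl
  have hWeq : W = B.orthogonal (Submodule.span K (Set.range ![e, f])) := by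
    ext w; rw [hW, mem_orthogonal_span_pair_iff hs]
  have hPW := LinearMap.BilinForm.isCompl_orthogonal_of_restrict_nondegenerate hrefl
    (restrict_span_pair_nondegenerate hs he hf hef)
  rw [LinearMap.BilinForm.restrict_nondegenerate_iff_isCompl_orthogonal hrefl, hWeq,
    LinearMap.BilinForm.orthogonal_orthogonal hB hrefl]
  exact hPW.symm

variable [CharZero K]

/-- **`𝔤_2` positionally**: `y ∈ 𝔰𝔬(V, B)` has degree `2` iff `y V_2 = 0`, `y V_{-2} ⊆ V_0` and `y V_0 ⊆ V_2`
(characteristic `0`: on `V_2` the eigen-equation reads `h(ye) = 4 ye`, and `4` is not an eigenvalue of `h`).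
[cite: LooijengaLunts1997, §2 (2.9) p. 10 L101–L103 ("𝔤_{±2} projects isomorphically to Hom(V_0, V_{±2})")] -/
theorem mem_adDegree_two_iff_apply (hs : ∀ u v : V, B u v = B v u) (he : B e e = 0) (hf : B f f = 0)
    (hef : B e f = 1) (hW : ∀ w, w ∈ W ↔ B w e = 0 ∧ B w f = 0) (x : skewAdjointLieSubalgebra B)
    (hx : (x : Module.End K V) = (2 : K) • ((B.flip f).smulRight e - (B.flip e).smulRight f))
    (y : skewAdjointLieSubalgebra B) :
    y ∈ adDegree K x 2 ↔ (y : Module.End K V) e = 0 ∧ (y : Module.End K V) f ∈ W ∧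
      ∀ w ∈ W, (y : Module.End K V) w ∈ K ∙ e := by
  refine ⟨fun hy ↦ ?_, fun ⟨h₁, h₂, h₀⟩ ↦ mem_adDegree_two_of_apply hs he hf hef hW x hx y h₁ h₂ h₀⟩
  obtain ⟨hxe, hxf, hx0⟩ := hyperbolicGrading_apply_eq (K := K) hs he hf hef
  rw [← hx] at hxe hxf hx0
  rw [LagrangianSplittingGrading.mem_adDegree_iff_apply] at hy
  refine ⟨?_, ?_, fun w hw ↦ ?_⟩
  · -- `x (y e) = 4 (y e)`
    have h := hy e
    rw [hxe, map_smul, sub_eq_iff_eq_add, ← add_smul] at h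
    refine eq_zero_of_apply_eq_smul hs he hf hef _ hx ?_ ?_ ?_ h <;> norm_num
  · -- `x (y f) = 0`
    have h := hy f
    rw [hxf, map_neg, map_smul, sub_neg_eq_add, add_eq_right] at h
    exact (hW _).2 ((apply_eq_zero_iff hs he hf hef _ hx _).1 h)
  · -- `x (y w) = 2 (y w)`
    obtain ⟨h1, h2⟩ := (hW w).1 hw
    have h := hy w
    rw [hx0 w h1 h2, map_zero, sub_zero] at h
    exact (apply_eq_two_smul_iff hs he hef _ hx _).1 h

/-- On `V_0` an element of `𝔤_2` is `w ↦ -B(w, y f) e`: it is determined by the vector `y f ∈ V_0`. [cite: LooijengaLunts1997, §2 (2.9) p. 10 L101–L103] -/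
theorem apply_eq_of_mem_adDegree_two (hs : ∀ u v : V, B u v = B v u) (he : B e e = 0) (hf : B f f = 0)
    (hef : B e f = 1) (hW : ∀ w, w ∈ W ↔ B w e = 0 ∧ B w f = 0) (x : skewAdjointLieSubalgebra B)
    (hx : (x : Module.End K V) = (2 : K) • ((B.flip f).smulRight e - (B.flip e).smulRight f))
    (y : skewAdjointLieSubalgebra B) (hy : y ∈ adDegree K x 2) {w : V} (hw : w ∈ W) :
    (y : Module.End K V) w = -(B w ((y : Module.End K V) f) • e) := by
  obtain ⟨-, -, h₀⟩ := (mem_adDegree_two_iff_apply hs he hf hef hW x hx y).1 hy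
  obtain ⟨c, hc⟩ := Submodule.mem_span_singleton.1 (h₀ w hw)
  have h := (LinearMap.mem_skewAdjointSubmodule (y : Module.End K V)).1 y.2 w f
  rw [Pi.neg_apply, LinearMap.BilinForm.neg_right, ← hc, LinearMap.BilinForm.smul_left, hef, mul_one] at h
  rw [← hc, h, neg_smul]

/-- **`y ∈ 𝔤_2` with `y f = 0` vanishes** (no non-degeneracy needed). [cite: LooijengaLunts1997, §2 (2.9) p. 10 L101–L103] -/
theorem eq_zero_of_mem_adDegree_two_of_apply_eq_zero (hs : ∀ u v : V, B u v = B v u) (he : B e e = 0)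
    (hf : B f f = 0) (hef : B e f = 1) (hW : ∀ w, w ∈ W ↔ B w e = 0 ∧ B w f = 0) (x : skewAdjointLieSubalgebra B)
    (hx : (x : Module.End K V) = (2 : K) • ((B.flip f).smulRight e - (B.flip e).smulRight f))
    (y : skewAdjointLieSubalgebra B) (hy : y ∈ adDegree K x 2) (h0 : (y : Module.End K V) f = 0) : y = 0 := by
  obtain ⟨h₁, -, -⟩ := (mem_adDegree_two_iff_apply hs he hf hef hW x hx y).1 hy
  apply Subtype.ext
  refine linearMap_eq_of_eq_on hs he hf hef _ _ (by rw [h₁]; rfl) (by rw [h0]; rfl) fun w h1 h2 ↦ ?_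
  rw [apply_eq_of_mem_adDegree_two hs he hf hef hW x hx y hy ((hW w).2 ⟨h1, h2⟩), h0, LinearMap.BilinForm.zero_right,
    zero_smul, neg_zero]
  rfl

/-- **`𝔤_2 ≅ V_0` by `y ↦ y f`**: for every `u ∈ V_0` there is a unique `y ∈ 𝔤_2` with `y f = u`, namely
`y_u = B(·, e) u - B(u, ·) e` (`y_u e = 0`, `y_u f = u`, `y_u w = -B(u, w) e`). [cite: LooijengaLunts1997, §2 (2.9) p. 10 L101–L103 ("𝔤_{±2} projects isomorphically to Hom(V_0, V_{±2})")] -/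
theorem existsUnique_mem_adDegree_two_apply_eq (hs : ∀ u v : V, B u v = B v u) (he : B e e = 0) (hf : B f f = 0)
    (hef : B e f = 1) (hW : ∀ w, w ∈ W ↔ B w e = 0 ∧ B w f = 0) (x : skewAdjointLieSubalgebra B)
    (hx : (x : Module.End K V) = (2 : K) • ((B.flip f).smulRight e - (B.flip e).smulRight f)) {u : V}
    (hu : u ∈ W) : ∃! y : skewAdjointLieSubalgebra B, y ∈ adDegree K x 2 ∧ (y : Module.End K V) f = u := by
  obtain ⟨hue, huf⟩ := (hW u).1 hu
  have happ : ∀ v, ((B.flip e).smulRight u - (B u).smulRight e : Module.End K V) v = B v e • u - B u v • e :=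
    fun v ↦ by simp only [LinearMap.sub_apply, LinearMap.smulRight_apply, LinearMap.BilinForm.flip_apply]
  set y : skewAdjointLieSubalgebra B := ⟨_, smulRight_sub_smulRight_mem_skewAdjointLieSubalgebra' hs e u⟩ with hy
  have hyf : (y : Module.End K V) f = u := by
    change ((B.flip e).smulRight u - (B u).smulRight e : Module.End K V) f = u
    rw [happ, hs f e, hef, huf, one_smul, zero_smul, sub_zero]
  have hy2 : y ∈ adDegree K x 2 := by
    refine mem_adDegree_two_of_apply hs he hf hef hW x hx y ?_ ?_ fun w hw ↦ ?_
    · change ((B.flip e).smulRight u - (B u).smulRight e : Module.End K V) e = 0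
      rw [happ, he, hue, zero_smul, zero_smul, sub_zero]
    · rw [hyf]; exact hu
    · change ((B.flip e).smulRight u - (B u).smulRight e : Module.End K V) w ∈ K ∙ e
      rw [happ, ((hW w).1 hw).1, zero_smul, zero_sub, ← neg_smul]
      exact Submodule.mem_span_singleton.2 ⟨_, rfl⟩
  refine ⟨y, ⟨hy2, hyf⟩, fun y' ⟨hy', hy'f⟩ ↦ ?_⟩
  rw [← sub_eq_zero]
  refine eq_zero_of_mem_adDegree_two_of_apply_eq_zero hs he hf hef hW x hx (y' - y) (Submodule.sub_mem _ hy' hy2) ?_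
  change ((y' : Module.End K V) - (y : Module.End K V)) f = 0
  rw [LinearMap.sub_apply, hy'f, hyf, sub_self]

/-- **`y ∈ 𝔤_2` vanishing on `V_0` vanishes** (`B` non-degenerate): `B(w, y f) = 0` for all `w ∈ V_0` and
`y f ∈ V_0`, so `y f = 0`. [cite: LooijengaLunts1997, §2 (2.9) p. 10 L101–L103 ("𝔤_{±2} projects isomorphically to Hom(V_0, V_{±2})")] -/
theorem eq_zero_of_mem_adDegree_two_of_forall_apply_eq_zero [FiniteDimensional K V] (hB : B.Nondegenerate)
    (hs : ∀ u v : V, B u v = B v u) (he : B e e = 0) (hf : B f f = 0) (hef : B e f = 1)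
    (hW : ∀ w, w ∈ W ↔ B w e = 0 ∧ B w f = 0) (x : skewAdjointLieSubalgebra B)
    (hx : (x : Module.End K V) = (2 : K) • ((B.flip f).smulRight e - (B.flip e).smulRight f))
    (y : skewAdjointLieSubalgebra B) (hy : y ∈ adDegree K x 2) (h0 : ∀ w ∈ W, (y : Module.End K V) w = 0) : y = 0 := by
  obtain ⟨-, h₂, -⟩ := (mem_adDegree_two_iff_apply hs he hf hef hW x hx y).1 hy
  refine eq_zero_of_mem_adDegree_two_of_apply_eq_zero hs he hf hef hW x hx y hy ?_
  have hnd := restrict_nondegenerate_of_hyperbolic hB hs he hf hef hW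
  have key : (⟨(y : Module.End K V) f, h₂⟩ : W) = 0 := by
    refine hnd.2 _ fun w ↦ ?_
    rw [LinearMap.BilinForm.restrict_apply, LinearMap.domRestrict_apply]
    have h := apply_eq_of_mem_adDegree_two hs he hf hef hW x hx y hy w.2
    rw [h0 w w.2, eq_comm, neg_eq_zero, smul_eq_zero] at h
    exact h.resolve_right fun he0 ↦ by rw [he0, LinearMap.BilinForm.zero_left] at hef; exact zero_ne_one hef
  exact congrArg Subtype.val key

/-- **"`𝔤_2` projects isomorphically to `Hom(V_0, V_2)`"** (`B` non-degenerate, `V` finite-dimensional): for every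
linear `φ : V_0 → V` with values in `V_2 = Ke` there is a unique `y ∈ 𝔤_2` with `y|_{V_0} = φ`. [cite: LooijengaLunts1997, §2 (2.9) p. 10 L101–L103 ("𝔤_{±2} projects isomorphically to Hom(V_0, V_{±2})")] -/
theorem existsUnique_mem_adDegree_two_restrict_eq [FiniteDimensional K V] (hB : B.Nondegenerate)
    (hs : ∀ u v : V, B u v = B v u) (he : B e e = 0) (hf : B f f = 0) (hef : B e f = 1)
    (hW : ∀ w, w ∈ W ↔ B w e = 0 ∧ B w f = 0) (x : skewAdjointLieSubalgebra B)
    (hx : (x : Module.End K V) = (2 : K) • ((B.flip f).smulRight e - (B.flip e).smulRight f)) (φ : W →ₗ[K] V)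
    (hφ : ∀ w, φ w ∈ K ∙ e) :
    ∃! y : skewAdjointLieSubalgebra B, y ∈ adDegree K x 2 ∧ ∀ w : W, (y : Module.End K V) w = φ w := by
  have hnd := restrict_nondegenerate_of_hyperbolic hB hs he hf hef hW
  -- the coefficient functional `c`, `φ w = c(w) e`, `c(w) = B(φ w, f)`
  let c : Module.Dual K W := (B.flip f) ∘ₗ φ
  have hc : ∀ w, φ w = c w • e := fun w ↦ by
    obtain ⟨a, ha⟩ := Submodule.mem_span_singleton.1 (hφ w)
    rw [← ha, LinearMap.comp_apply, LinearMap.BilinForm.flip_apply, ← ha, LinearMap.BilinForm.smul_left, hef, mul_one]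
  -- Riesz in `(V_0, B|_{V_0})`: `u ∈ V_0` with `B(w, u) = -c(w)`
  let u : W := -((B.restrict W).toDual hnd).symm c
  have hu : ∀ w : W, B (w : V) u = -c w := fun w ↦ by
    rw [show (u : V) = -((((B.restrict W).toDual hnd).symm c : W) : V) from rfl, LinearMap.BilinForm.neg_right, hs,
      ← LinearMap.BilinForm.apply_toDual_symm_apply (hB := hnd) c w, LinearMap.BilinForm.restrict_apply,
      LinearMap.domRestrict_apply]
  obtain ⟨y, ⟨hy2, hyf⟩, -⟩ := existsUnique_mem_adDegree_two_apply_eq hs he hf hef hW x hx u.2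
  have hyw : ∀ w : W, (y : Module.End K V) w = φ w := fun w ↦ by
    rw [apply_eq_of_mem_adDegree_two hs he hf hef hW x hx y hy2 w.2, hyf, hu, neg_smul, neg_neg, hc]
  refine ⟨y, ⟨hy2, hyw⟩, fun y' ⟨hy', hy'w⟩ ↦ ?_⟩
  rw [← sub_eq_zero]
  refine eq_zero_of_mem_adDegree_two_of_forall_apply_eq_zero hB hs he hf hef hW x hx (y' - y)
    (Submodule.sub_mem _ hy' hy2) fun w hw ↦ ?_
  change ((y' : Module.End K V) - (y : Module.End K V)) w = 0
  rw [LinearMap.sub_apply, hy'w ⟨w, hw⟩, hyw ⟨w, hw⟩, sub_self]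

end DegreeTwo

/-! ### §9 `𝔤_{-2}` by the symmetry `e ↔ f` (`h_{f,e} = -h_{e,f}`, `𝔤_{-2}(h) = 𝔤_2(-h)`) -/

section DegreeNegTwo

variable {e f : V} {W : Submodule K V}

/-- `-h_{e,f} = h_{f,e}`: the opposite grading element is the grading element of the swapped pair. [cite: LooijengaLunts1997, §2 (2.9) p. 10 L100–L101] -/
theorem neg_hyperbolicGrading_eq (x : skewAdjointLieSubalgebra B)
    (hx : (x : Module.End K V) = (2 : K) • ((B.flip f).smulRight e - (B.flip e).smulRight f)) :
    ((-x : skewAdjointLieSubalgebra B) : Module.End K V) = (2 : K) • ((B.flip e).smulRight f - (B.flip f).smulRight e) := by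
  rw [show ((-x : skewAdjointLieSubalgebra B) : Module.End K V) = -(x : Module.End K V) from rfl, hx, ← smul_neg,
    neg_sub]

variable [CharZero K]

/-- **`𝔤_{-2}` positionally**: `y` has degree `-2` iff `y V_{-2} = 0`, `y V_2 ⊆ V_0` and `y V_0 ⊆ V_{-2}`. [cite: LooijengaLunts1997, §2 (2.9) p. 10 L101–L103 ("𝔤_{±2} projects isomorphically to Hom(V_0, V_{±2})")] -/
theorem mem_adDegree_neg_two_iff_apply (hs : ∀ u v : V, B u v = B v u) (he : B e e = 0) (hf : B f f = 0)
    (hef : B e f = 1) (hW : ∀ w, w ∈ W ↔ B w e = 0 ∧ B w f = 0) (x : skewAdjointLieSubalgebra B)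
    (hx : (x : Module.End K V) = (2 : K) • ((B.flip f).smulRight e - (B.flip e).smulRight f))
    (y : skewAdjointLieSubalgebra B) :
    y ∈ adDegree K x (-2) ↔ (y : Module.End K V) f = 0 ∧ (y : Module.End K V) e ∈ W ∧
      ∀ w ∈ W, (y : Module.End K V) w ∈ K ∙ f := by
  rw [← adDegree_neg]
  exact mem_adDegree_two_iff_apply hs hf he (by rw [hs]; exact hef) (fun w ↦ (hW w).trans and_comm) (-x)
    (neg_hyperbolicGrading_eq x hx) y

/-- On `V_0` an element of `𝔤_{-2}` is `w ↦ -B(w, y e) f`. [cite: LooijengaLunts1997, §2 (2.9) p. 10 L101–L103] -/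
theorem apply_eq_of_mem_adDegree_neg_two (hs : ∀ u v : V, B u v = B v u) (he : B e e = 0) (hf : B f f = 0)
    (hef : B e f = 1) (hW : ∀ w, w ∈ W ↔ B w e = 0 ∧ B w f = 0) (x : skewAdjointLieSubalgebra B)
    (hx : (x : Module.End K V) = (2 : K) • ((B.flip f).smulRight e - (B.flip e).smulRight f))
    (y : skewAdjointLieSubalgebra B) (hy : y ∈ adDegree K x (-2)) {w : V} (hw : w ∈ W) :
    (y : Module.End K V) w = -(B w ((y : Module.End K V) e) • f) := by
  rw [← adDegree_neg] at hy
  exact apply_eq_of_mem_adDegree_two hs hf he (by rw [hs]; exact hef) (fun w ↦ (hW w).trans and_comm) (-x)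
    (neg_hyperbolicGrading_eq x hx) y hy hw

/-- **`𝔤_{-2} ≅ V_0` by `y ↦ y e`**: for every `u ∈ V_0` there is a unique `y ∈ 𝔤_{-2}` with `y e = u`. [cite: LooijengaLunts1997, §2 (2.9) p. 10 L101–L103 ("𝔤_{±2} projects isomorphically to Hom(V_0, V_{±2})")] -/
theorem existsUnique_mem_adDegree_neg_two_apply_eq (hs : ∀ u v : V, B u v = B v u) (he : B e e = 0)
    (hf : B f f = 0) (hef : B e f = 1) (hW : ∀ w, w ∈ W ↔ B w e = 0 ∧ B w f = 0) (x : skewAdjointLieSubalgebra B)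
    (hx : (x : Module.End K V) = (2 : K) • ((B.flip f).smulRight e - (B.flip e).smulRight f)) {u : V}
    (hu : u ∈ W) : ∃! y : skewAdjointLieSubalgebra B, y ∈ adDegree K x (-2) ∧ (y : Module.End K V) e = u := by
  rw [← adDegree_neg]
  exact existsUnique_mem_adDegree_two_apply_eq hs hf he (by rw [hs]; exact hef) (fun w ↦ (hW w).trans and_comm) (-x)
    (neg_hyperbolicGrading_eq x hx) hu

/-- **"`𝔤_{-2}` projects isomorphically to `Hom(V_0, V_{-2})`"** (`B` non-degenerate, `V` finite-dimensional).
[cite: LooijengaLunts1997, §2 (2.9) p. 10 L101–L103 ("𝔤_{±2} projects isomorphically to Hom(V_0, V_{±2})")] -/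
theorem existsUnique_mem_adDegree_neg_two_restrict_eq [FiniteDimensional K V] (hB : B.Nondegenerate)
    (hs : ∀ u v : V, B u v = B v u) (he : B e e = 0) (hf : B f f = 0) (hef : B e f = 1)
    (hW : ∀ w, w ∈ W ↔ B w e = 0 ∧ B w f = 0) (x : skewAdjointLieSubalgebra B)
    (hx : (x : Module.End K V) = (2 : K) • ((B.flip f).smulRight e - (B.flip e).smulRight f)) (φ : W →ₗ[K] V)
    (hφ : ∀ w, φ w ∈ K ∙ f) :
    ∃! y : skewAdjointLieSubalgebra B, y ∈ adDegree K x (-2) ∧ ∀ w : W, (y : Module.End K V) w = φ w := by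
  rw [← adDegree_neg]
  exact existsUnique_mem_adDegree_two_restrict_eq hB hs hf he (by rw [hs]; exact hef) (fun w ↦ (hW w).trans and_comm)
    (-x) (neg_hyperbolicGrading_eq x hx) φ hφ

end DegreeNegTwo

/-! ### §10 "isotropic lines `V_{±2}` such that `V_{-2} ⊕ V_2` is nondegenerate": from lines to a hyperbolic pair, and `h` depends on the lines only -/

section Lines

/-- **`h` depends only on the lines `V_2 = Ke`, `V_{-2} = Kf`**: another hyperbolic pair `e' ∈ Ke`, `f' ∈ Kf`
(`B(e', f') = 1`) has the same grading element. [cite: LooijengaLunts1997, §2 (2.9) p. 10 L96–L101 ("let V_{±2} be isotropic lines … h ∈ 𝔰𝔬(V) the element with the eigen space decomposition V_{-2} ⊕ V_0 ⊕ V_2")] -/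
theorem hyperbolicGrading_eq_of_mem_span {e f e' f' : V} (hef : B e f = 1) (he' : e' ∈ K ∙ e) (hf' : f' ∈ K ∙ f)
    (hef' : B e' f' = 1) :
    ((2 : K) • ((B.flip f').smulRight e' - (B.flip e').smulRight f') : Module.End K V) =
      (2 : K) • ((B.flip f).smulRight e - (B.flip e).smulRight f) := by
  obtain ⟨c, rfl⟩ := Submodule.mem_span_singleton.1 he'
  obtain ⟨d, rfl⟩ := Submodule.mem_span_singleton.1 hf'
  rw [LinearMap.BilinForm.smul_left, LinearMap.BilinForm.smul_right, hef, mul_one] at hef'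
  congr 1
  ext v
  simp only [LinearMap.sub_apply, LinearMap.smulRight_apply, LinearMap.BilinForm.flip_apply,
    LinearMap.BilinForm.smul_right, smul_smul]
  rw [mul_right_comm d (B v f) c, mul_comm d c, hef', one_mul, mul_right_comm c (B v e) d, hef', one_mul]

/-- From an isotropic line `Kf₀` not orthogonal to `e₀` to a hyperbolic partner of `e₀` on that line. [cite: LooijengaLunts1997, §2 (2.9) p. 10 L96–L99 ("isotropic lines in V such that V_{-2} ⊕ V_2 is nondegenerate")] -/
theorem exists_mem_span_isotropic_pairing_one {e₀ f₀ : V} (hf₀ : B f₀ f₀ = 0) (h : B e₀ f₀ ≠ 0) :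
    ∃ f ∈ K ∙ f₀, B f f = 0 ∧ B e₀ f = 1 := by
  refine ⟨(B e₀ f₀)⁻¹ • f₀, Submodule.mem_span_singleton.2 ⟨_, rfl⟩, ?_, ?_⟩
  · rw [LinearMap.BilinForm.smul_left, LinearMap.BilinForm.smul_right, hf₀, mul_zero, mul_zero]
  · rw [LinearMap.BilinForm.smul_right, inv_mul_cancel₀ h]

/-- **"`V_{-2} ⊕ V_2` nondegenerate" forces `B(e₀, f₀) ≠ 0`** for the isotropic generators `e₀ ≠ 0`, `f₀` of the two
lines (otherwise `e₀` is in the radical of the plane). [cite: LooijengaLunts1997, §2 (2.9) p. 10 L96–L99] -/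
theorem apply_ne_zero_of_restrict_span_pair_nondegenerate {e₀ f₀ : V} (he₀ : B e₀ e₀ = 0) (hne : e₀ ≠ 0)
    (hnd : (B.restrict (Submodule.span K (Set.range ![e₀, f₀]))).Nondegenerate) : B e₀ f₀ ≠ 0 := by
  intro h0
  have hmem : e₀ ∈ Submodule.span K (Set.range ![e₀, f₀]) := Submodule.subset_span ⟨0, rfl⟩
  have key : (⟨e₀, hmem⟩ : Submodule.span K (Set.range ![e₀, f₀])) = 0 := by
    refine hnd.1 _ fun p ↦ ?_
    obtain ⟨p, hp⟩ := p
    obtain ⟨c, rfl⟩ := (Submodule.mem_span_range_iff_exists_fun K).1 hp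
    rw [LinearMap.BilinForm.restrict_apply, LinearMap.domRestrict_apply]
    simp only [Fin.sum_univ_two, Matrix.cons_val_zero, Matrix.cons_val_one, LinearMap.BilinForm.add_right,
      LinearMap.BilinForm.smul_right, he₀, h0, mul_zero, add_zero]
  exact hne (congrArg Subtype.val key)

variable [CharZero K] [IsAlgClosed K] [FiniteDimensional K V]

/-- **(2.9), orthogonal cases, with the data AS PRINTED — two isotropic LINES**: `B` non-degenerate symmetric,
`dim V ≥ 3`, `e₀ ≠ 0` and `f₀` isotropic spanning lines `V_2`, `V_{-2}` "such that `V_{-2} ⊕ V_2` is nondegenerate";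
then for the hyperbolic partner `f ∈ V_{-2}` of `e₀` the element `h_{e₀,f}` (which depends only on the two lines,
`hyperbolicGrading_eq_of_mem_span`) makes `(𝔰𝔬(V, B), h)` a Jordan–Lefschetz pair (row A1-203).
[cite: LooijengaLunts1997, §2 (2.9) p. 10 L94–L103] -/
theorem exists_isJordanLefschetzPair_of_isotropic_lines (hB : B.Nondegenerate) (hs : ∀ u v : V, B u v = B v u)
    (h3 : 3 ≤ finrank K V) {e₀ f₀ : V} (he₀ : B e₀ e₀ = 0) (hf₀ : B f₀ f₀ = 0) (hne : e₀ ≠ 0)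
    (hnd : (B.restrict (Submodule.span K (Set.range ![e₀, f₀]))).Nondegenerate) :
    ∃ f ∈ K ∙ f₀, ∃ _ : B f f = 0 ∧ B e₀ f = 1,
      IsJordanLefschetzPair K (⟨(2 : K) • ((B.flip f).smulRight e₀ - (B.flip e₀).smulRight f),
        hyperbolicGrading_mem_skewAdjointLieSubalgebra hs e₀ f⟩ : skewAdjointLieSubalgebra B) := by
  obtain ⟨f, hf, hff, h1⟩ := exists_mem_span_isotropic_pairing_one hf₀
    (apply_ne_zero_of_restrict_span_pair_nondegenerate he₀ hne hnd)
  exact ⟨f, hf, ⟨hff, h1⟩, isJordanLefschetzPair_hyperbolicGrading_mk hB hs h3 he₀ hff h1⟩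

end Lines

end Literature.Algebra.Lie.HyperbolicPlaneGrading
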